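import Mathlib
import Summits.NavierStokesRegularity.NavierStokesRegularity.Theorems.EulerZoomLiouvillePowerGaugeEulerLiouvilleHoopInequalityTransverse
import Summits.NavierStokesRegularity.NavierStokesRegularity.Theorems.EulerZoomLiouvillePowerGaugeEulerLiouvilleHoopAxisLawCentre
import HarnessLib

/-!
# Hoop core — TJ-CORE: the integrated axis-vs-ambient pressure drop is paid by the Dirichlet energy of the cylinder

Sub-problem `NavierStokesRegularity`, crux `PowerGaugeEulerLiouville` (a crux CLASS of self-similar Euler/NS strata on the
MODEL lattice — not NS regularity, not E).  Seat ns-ezl-w3 g7 (tag TJ-CORE; HOOP-NOTE §4 CONSEQUENCE / §10(a)).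

`integral_axisPressureDrop_le` — for a `C²` self-similar Euler profile pair `IsSelfSimilarEulerProfile γ c V P` with an ARBITRARY
centre `c`, every straight segment `[s₁, s₂]` of the `x₂`-axis (`s₁ < s₂`) and every radius `T₀ > 0`, with `Z = solidCyl s₁ s₂ T₀`:

`2π ∫_{s₁}^{s₂} (P(σe_z) − ⟨P⟩_θ(σ,T₀)) dσ ≤ ∫_Z |DV|_F² + endFlux V s₁ T₀ + endFlux V s₂ T₀`
`  + 2π(1−3γ) ∫_{s₁}^{s₂}∫₀^{T₀} ⟨V_r⟩_θ dt dσ + 2π ∫_{s₁}^{s₂} ⟨(γr + V_r)V_r⟩_θ(σ,T₀) dσ + 2π([endTermC]_{s₁}^{s₂} − [offsetTerm]_{s₁}^{s₂})`.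

Proof: the general-line axis law `HoopCore.axisLawCentre` (AX∫, ns-sfl-p1 g8 over the LEAD's AX-2/AX-3) expresses the left side
as hoop term − ½·(transverse axis atom) + the displayed terms; the hoop inequality with the TRANSVERSE atom
(`hoop_axisUnits_le`, this seat) bounds `2π·hoop ≤ ∫_Z|DV|_F² + π·atom + end fluxes`; the two atoms cancel exactly.
So a straight pressurised axis segment (`P(σe_z) − ⟨P⟩_θ(σ,T₀) ≥ c₁σ²`) of length `L` costs Dirichlet energy `≥ 2πc₁s²L` up to the
end / lateral / flux terms — the class-free core the K-TJ′ member quantifies against the E-budget (`≲ c s^{1−ρ}` per shell).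
Also: `integral_axisPressureDrop_le_radial` (centre `0`: `endTerm`, no offset term).

WHAT THIS IS NOT: not NS, not E — an inequality for hypothetical profiles; 19832 OPEN; NS regularity NOT proved.
[ns-idea-11 g8 HOOP NOTE §4 (CONSEQUENCE), §10(a)]
-/

noncomputable section

open MeasureTheory Set WithLp Metric Real Function
open scoped InnerProductSpace RealInnerProductSpace

set_option linter.dupNamespace false

namespace Summit.NavierStokesRegularity.NavierStokesRegularity.Theorems.PowerGaugeEulerLiouville.HoopCore

open Literature.Analysis Literature.Analysis.FluidPDE Condenser

variable {V : EuclideanSpace ℝ (Fin 3) → EuclideanSpace ℝ (Fin 3)}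

/-- **TJ-CORE — THE AXIS PRESSURE DROP IS PAID BY DIRICHLET ENERGY** (general centre `c`; HOOP-NOTE §4 CONSEQUENCE): for a `C²`
self-similar Euler profile pair `IsSelfSimilarEulerProfile γ c V P`, `s₁ < s₂`, `0 < T₀`, `Z = solidCyl s₁ s₂ T₀`,
`2π ∫_{s₁}^{s₂} (P(σe_z) − ⟨P⟩_θ(σ,T₀)) dσ ≤ ∫_Z |DV|_F² + endFlux V s₁ T₀ + endFlux V s₂ T₀ + 2π(1−3γ)∫∫⟨V_r⟩_θ`
`+ 2π ∫ ⟨(γr + V_r)V_r⟩_θ(σ,T₀) dσ + 2π((endTermC s₂ − endTermC s₁) − (offsetTerm s₂ − offsetTerm s₁))`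
(`axisLawCentre` + `hoop_axisUnits_le`; the transverse axis atoms cancel). [ns-idea-11 g8 HOOP NOTE §4] -/
theorem integral_axisPressureDrop_le {γ : ℝ} {c : EuclideanSpace ℝ (Fin 3)} {P : EuclideanSpace ℝ (Fin 3) → ℝ}
    (hprof : IsSelfSimilarEulerProfile γ c V P) {s₁ s₂ T₀ : ℝ} (hs : s₁ < s₂) (hT₀ : 0 < T₀) :
    2 * Real.pi * ∫ σ in s₁..s₂, (P (σ • eZ) - circleAvg P σ T₀)
      ≤ (∫ y in solidCyl s₁ s₂ T₀, frobeniusNormSq (fderiv ℝ V y)) + endFlux V s₁ T₀ + endFlux V s₂ T₀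
        + 2 * Real.pi * ((1 - 3 * γ) * (∫ σ in s₁..s₂, ∫ t in (0 : ℝ)..T₀, circleAvg (radialVelocity V) σ t))
        + 2 * Real.pi * (∫ σ in s₁..s₂,
            circleAvg (fun y => (γ * cylRadius y + radialVelocity V y) * radialVelocity V y) σ T₀)
        + 2 * Real.pi * ((endTermC γ c V T₀ s₂ - endTermC γ c V T₀ s₁)
            - (offsetTerm γ c V T₀ s₂ - offsetTerm γ c V T₀ s₁)) := by
  have hV1 : ContDiff ℝ 1 V := hprof.contDiff_velocity.of_le (by norm_num)
  have hAX := axisLawCentre γ c V P hprof s₁ s₂ T₀ hs.le hT₀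
  have hH := hoop_axisUnits_le hV1 hprof.divFree hs hT₀
  rw [hAX]
  nlinarith [hH, Real.pi_pos]

/-- **TJ-CORE, radial axis (centre `0`)**: `2π ∫_{s₁}^{s₂} (P(σe_z) − ⟨P⟩_θ(σ,T₀)) dσ ≤ ∫_Z |DV|_F² + endFlux s₁ + endFlux s₂`
`+ 2π(1−3γ)∫∫⟨V_r⟩_θ + 2π∫⟨(γr + V_r)V_r⟩_θ(σ,T₀) + 2π(endTerm γ V T₀ s₂ − endTerm γ V T₀ s₁)`
(`axisLawIntegrated` + `hoop_axisUnits_le`). [ns-idea-11 g8 HOOP NOTE §4] -/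
theorem integral_axisPressureDrop_le_radial {γ : ℝ} {P : EuclideanSpace ℝ (Fin 3) → ℝ}
    (hprof : IsSelfSimilarEulerProfile γ 0 V P) {s₁ s₂ T₀ : ℝ} (hs : s₁ < s₂) (hT₀ : 0 < T₀) :
    2 * Real.pi * ∫ σ in s₁..s₂, (P (σ • eZ) - circleAvg P σ T₀)
      ≤ (∫ y in solidCyl s₁ s₂ T₀, frobeniusNormSq (fderiv ℝ V y)) + endFlux V s₁ T₀ + endFlux V s₂ T₀
        + 2 * Real.pi * ((1 - 3 * γ) * (∫ σ in s₁..s₂, ∫ t in (0 : ℝ)..T₀, circleAvg (radialVelocity V) σ t))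
        + 2 * Real.pi * (∫ σ in s₁..s₂,
            circleAvg (fun y => (γ * cylRadius y + radialVelocity V y) * radialVelocity V y) σ T₀)
        + 2 * Real.pi * (endTerm γ V T₀ s₂ - endTerm γ V T₀ s₁) := by
  have h := integral_axisPressureDrop_le hprof hs hT₀
  rw [endTermC_zero, offsetTerm_zero, offsetTerm_zero, sub_zero, sub_zero] at h
  exact h

end Summit.NavierStokesRegularity.NavierStokesRegularity.Theorems.PowerGaugeEulerLiouville.HoopCore

end
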